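import Summits.QuantumFields.YangMills.Theses.PoincareLipschitz
import Summits.QuantumFields.YangMills.Theorems.UnitScaleGibbsBoxPeierlsPolynomial
import Summits.QuantumFields.YangMills.Theorems.BalabanUVNodesN07ShearSizeTopBox
import Literature.MathematicalPhysics.QuantumFieldTheory.Balaban1983to89.T4AxialGaugeSmallField
import HarnessLib

/-!
# LINE 29 «CombPeierls» — `stub_axialCombTransfer` AS REGISTERED (stmt-QuantumFields-23532): the deterministic comb transfer on a
# non-wrapping box

Crux of record `PoincareLipschitz.MesoscopicConcentrationL` (stmt-QuantumFields-23532; skeleton v1 `Cruxes/HistoryTailL/Lines/comb_peierls.lean`,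
sha16 34f13369a15a4c92, ideator ym-r3-idea-2 g16), cell `ym3-torus` (YM ladder rung R3 = continuum `SU(2)` Yang–Mills on T³ — a RUNG, NOT the Clay
problem); width seat `ym3-torus-px16` gen 11.

THE STUB (registered text, 942 chars).  For a box of side `n` based at `x₀` (`1 ≤ n`, `2n ≤ sitesPerDir 0`; integer corners `lo = x₀.val`,
`hi = x₀.val + (n − 1)`), a GAUGE-INVARIANT, BOX-LOCAL (depends only on the bonds with both ends in the `ZMod` box `{s | (s k − x₀ k).val < n ∀k}`),
`Λ`-link-Lipschitz observable `f`:
(i) `#boxPlaqs lo hi ≤ 3·(n+1)³`; (ii) if every box plaquette is `δ`-small then `|f(U) − f(𝟙)| ≤ Λ·4n³·δ`.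

THE PROOF (bookkeeping over LANDED letters).
* (i) is ym3-torus-px8 g9's count ✓ `UnitScaleGibbsBoxPeierlsPolynomial.card_filter_mem_boxPlaqs_le` (`Finset.filter` form), moved to `Set.ncard` by
  `Set.ncard_eq_toFinset_card'` ∕ `Set.filter_mem_univ_eq_toFinset`.
* (ii): `f U = f (U^g)`, `g := axialGauge U lo hi` (gauge invariance); box-locality replaces `U^g` by the configuration `W` equal to `U^g` on the bonds of the
  `ZMod` box and `1` elsewhere; the Lipschitz row against `𝟙` gives `|f W − f 𝟙| ≤ Λ·√(Σ_{box bonds} dist₁(U^g b)²)`; a bond with both ends in the `ZMod` box is a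
  box bond of pv26's `boxBonds lo hi` (dag-n07-w6 ✓ `N07ShearSizeTopBox.mem_boxBonds_of_ends_mem_box`, the box `[lo, hi]` having extent `n < sitesPerDir 0`), so the
  torus non-abelian Poincaré lemma ✓ `T4AxialGaugeSmallField.dist1_gaugeAct_axialGauge_le_of_mem_boxBonds` bounds it by `(d − 1)·n·δ = 2nδ`; at most `3n³` bonds
  start in the `ZMod` box (injection `b ↦ (dir b, (b.src − x₀).val)` into `Fin 3 × (Fin 3 → range n)`), whence `Σ ≤ 3n³·(2nδ)² ≤ (4n³δ)²`.

HONEST SCOPE.  Deterministic comb bookkeeping; proves the registered stub `stub_axialCombTransfer` of LINE 29 and NOTHING of `stub_uniformPlaquetteTail` (the line's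
new input), `stub_boxTailBookkeeping`, `stub_mesoscopicBoxConcentration`, K1 `MesoscopicConcentrationL` (23532), (Q), 23083, `HistoryTailL` (19936), EX (19200),
20520 or rung R3; R3 = continuum `SU(2)` YM on T³ — NOT d = 4, NOT infinite volume, NOT a mass gap, NOT Clay; the Yang–Mills mass gap is NOT proved.
THEOREMS ONLY (0 `def`, 0 `sorry`); `--supports stmt-QuantumFields-23532` (STUB mode).

References: M. Creutz, «Quarks, gluons and lattices» (1983) ch. 9 (maximal-tree ∕ axial gauge) [folklore]; T. Bałaban, CMP 102 (1985) 255–275, (11) p.258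
[Balaban1985UV3] (small-field plaquette condition on boxes).
-/

set_option autoImplicit false

open scoped BigOperators
open Literature.MathematicalPhysics.QuantumFieldTheory.Balaban1983to89
open Literature.MathematicalPhysics.QuantumFieldTheory.Balaban1983to89.T3ContinuumYM3Torus
open Literature.MathematicalPhysics.QuantumFieldTheory.Balaban1983to89.T4AxialGaugeSmallField
  (boxPlaqs boxBonds castSite castSite_apply axialGauge dist1_gaugeAct_axialGauge_le_of_mem_boxBonds)
open Literature.MathematicalPhysics.QuantumFieldTheory.Balaban1983to89.B7Prop1Explicit (e e_apply)
open Summit.QuantumFields.YangMills.Theorems.UnitScaleGibbsBoxPeierlsPolynomial (card_filter_mem_boxPlaqs_le)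
open Summit.QuantumFields.YangMills.BalabanUVNodes.N07ShearSizeTopBox (mem_boxBonds_of_ends_mem_box)

namespace Summit.QuantumFields.YangMills.Theorems.CombPeierlsStubAxialCombTransfer

/-! ## §1 The `ZMod` box of side `n` at `x₀` sits inside the integer box `[x₀.val, x₀.val + (n − 1)]` -/

section Box

variable {P : Params} {j : ℕ}

/-- A torus site whose coordinates relative to `x₀` have residues `< n` is the projection of an integer point of the box
`[x₀.val, x₀.val + (n − 1)]`. [folklore] -/
theorem mem_image_castSite_Icc_of_val_lt {n : ℕ} (x₀ s : Site P j) (hs : ∀ k, (s k - x₀ k).val < n) :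
    s ∈ (castSite '' Set.Icc (fun k => ((x₀ k).val : ℤ)) (fun k => ((x₀ k).val : ℤ) + ((n : ℤ) - 1)) : Set (Site P j)) := by
  refine ⟨fun k => ((x₀ k).val : ℤ) + (((s k - x₀ k).val : ℕ) : ℤ), ⟨fun k => ?_, fun k => ?_⟩, ?_⟩
  · show ((x₀ k).val : ℤ) ≤ ((x₀ k).val : ℤ) + (((s k - x₀ k).val : ℕ) : ℤ)
    have : (0 : ℤ) ≤ (((s k - x₀ k).val : ℕ) : ℤ) := by positivity
    linarith
  · show ((x₀ k).val : ℤ) + (((s k - x₀ k).val : ℕ) : ℤ) ≤ ((x₀ k).val : ℤ) + ((n : ℤ) - 1)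
    have h := hs k
    have h' : (((s k - x₀ k).val : ℕ) : ℤ) ≤ (n : ℤ) - 1 := by omega
    linarith
  · funext k
    simp only [castSite_apply, Int.cast_add, Int.cast_natCast, ZMod.natCast_zmod_val]
    abel

/-- A bond with both ends in the `ZMod` box of side `n` at `x₀` (`1 ≤ n`, `2n ≤ sitesPerDir j`) is a box bond of `boxBonds x₀.val (x₀.val + (n − 1))`. [folklore] -/
theorem mem_boxBonds_of_val_lt {n : ℕ} (hn : 1 ≤ n) (h2n : 2 * n ≤ P.sitesPerDir j) (x₀ : Site P j) (b : PBond P j)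
    (hs : ∀ k, (b.src k - x₀ k).val < n) (ht : ∀ k, (b.tgt k - x₀ k).val < n) :
    b ∈ (boxBonds (fun k => ((x₀ k).val : ℤ)) (fun k => ((x₀ k).val : ℤ) + ((n : ℤ) - 1)) : Set (PBond P j)) := by
  refine mem_boxBonds_of_ends_mem_box (fun κ => ?_) (mem_image_castSite_Icc_of_val_lt x₀ b.src hs)
    (mem_image_castSite_Icc_of_val_lt x₀ b.tgt ht)
  have : (n : ℤ) < (P.sitesPerDir j : ℤ) := by exact_mod_cast (show n < P.sitesPerDir j by omega)
  show ((x₀ κ).val : ℤ) + ((n : ℤ) - 1) + 1 - ((x₀ κ).val : ℤ) < (P.sitesPerDir j : ℤ)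
  linarith

/-- At most `d·n^d` bonds start in the `ZMod` box of side `n` at `x₀` (injection `b ↦ (b.dir, (b.src − x₀).val)` into `Fin d × (Fin d → range n)`). [folklore] -/
theorem card_filter_src_val_lt_le {n : ℕ} (x₀ : Site P j) :
    (Finset.univ.filter fun b : PBond P j => ∀ k, (b.src k - x₀ k).val < n).card ≤ P.d * n ^ P.d := by
  classical
  set T : Finset (Fin P.d × (Fin P.d → ℕ)) := Finset.univ ×ˢ Fintype.piFinset (fun _ : Fin P.d => Finset.range n) with hT
  have hmaps : Set.MapsTo (fun b : PBond P j => (b.dir, fun k => (b.src k - x₀ k).val))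
      (Finset.univ.filter fun b : PBond P j => ∀ k, (b.src k - x₀ k).val < n) T := by
    intro b hb
    have hb' := (Finset.mem_filter.1 hb).2
    simp only [hT, Finset.coe_product, Finset.coe_univ, Set.mem_prod, Set.mem_univ, true_and, Finset.mem_coe,
      Fintype.mem_piFinset, Finset.mem_range]
    exact hb'
  have hinj : Set.InjOn (fun b : PBond P j => (b.dir, fun k => (b.src k - x₀ k).val))
      (Finset.univ.filter fun b : PBond P j => ∀ k, (b.src k - x₀ k).val < n) := by
    intro b _ b' _ h
    have hdir : b.dir = b'.dir := congrArg Prod.fst h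
    have hval : (fun k => (b.src k - x₀ k).val) = fun k => (b'.src k - x₀ k).val := congrArg Prod.snd h
    have hsrc : b.src = b'.src := by
      funext k
      have hk : (b.src k - x₀ k).val = (b'.src k - x₀ k).val := congr_fun hval k
      have hk' : b.src k - x₀ k = b'.src k - x₀ k := ZMod.val_injective _ hk
      calc b.src k = (b.src k - x₀ k) + x₀ k := by abel
        _ = (b'.src k - x₀ k) + x₀ k := by rw [hk']
        _ = b'.src k := by abel
    cases b; cases b'
    simp only at hdir hsrc
    subst hdir hsrc
    rfl
  calc (Finset.univ.filter fun b : PBond P j => ∀ k, (b.src k - x₀ k).val < n).card ≤ T.card :=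
        Finset.card_le_card_of_injOn _ hmaps hinj
    _ = P.d * n ^ P.d := by
        rw [hT, Finset.card_product, Finset.card_univ, Fintype.card_fin, Fintype.card_piFinset_const, Finset.card_range]

end Box

/-! ## §2 The comb transfer for the member `F.P K` (`d = 3`) and the registered stub -/

section Member

variable (F : T3Family) (K : ℕ)

/-- The plaquette count of the stub: `#boxPlaqs x₀.val (x₀.val + (n − 1)) ≤ 3·(n+1)³` (`1 ≤ n`), `Set.ncard` form of px8 g9's `card_filter_mem_boxPlaqs_le`. [folklore] -/
theorem ncard_boxPlaqs_le {n : ℕ} (hn : 1 ≤ n) (x₀ : Site (F.P K) 0) :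
    ((boxPlaqs (P := F.P K) (j := 0) (fun k => ((x₀ k).val : ℤ)) (fun k => ((x₀ k).val : ℤ) + ((n : ℤ) - 1))).ncard : ℝ)
      ≤ 3 * ((n : ℝ) + 1) ^ 3 := by
  classical
  have hbox : ∀ κ, (fun k => ((x₀ k).val : ℤ)) κ ≤ (fun k => ((x₀ k).val : ℤ) + ((n : ℤ) - 1)) κ ∧
      (fun k => ((x₀ k).val : ℤ) + ((n : ℤ) - 1)) κ ≤ (fun k => ((x₀ k).val : ℤ)) κ + n := fun κ => by
    have h1 : (1 : ℤ) ≤ (n : ℤ) := by exact_mod_cast hn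
    constructor
    · show ((x₀ κ).val : ℤ) ≤ ((x₀ κ).val : ℤ) + ((n : ℤ) - 1); linarith
    · show ((x₀ κ).val : ℤ) + ((n : ℤ) - 1) ≤ ((x₀ κ).val : ℤ) + n; linarith
  have h := card_filter_mem_boxPlaqs_le F K _ _ n hbox
  rw [Set.ncard_eq_toFinset_card', ← Set.filter_mem_univ_eq_toFinset]
  convert h using 3

/-- **THE COMB TRANSFER** (pointwise form): on a box of side `n` at `x₀` (`1 ≤ n`, `2n ≤ sitesPerDir 0`) a gauge-invariant, box-local, `Λ`-link-Lipschitz `f` satisfies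
`|f U − f 𝟙| ≤ Λ·4n³·δ` whenever every box plaquette of `U` is `δ`-small (`0 ≤ δ`). [folklore] -/
theorem abs_sub_one_le_of_plaqSmallOn {n : ℕ} (hn : 1 ≤ n) (h2n : 2 * n ≤ (F.P K).sitesPerDir 0) (x₀ : Site (F.P K) 0)
    (f : GaugeField (F.P K) 0 (Matrix.specialUnitaryGroup (Fin 2) ℂ) → ℝ) {Λ : ℝ} (hΛ : 0 ≤ Λ) (hfG : GaugeField.GaugeInvariant f)
    (hloc : ∀ U U' : GaugeField (F.P K) 0 (Matrix.specialUnitaryGroup (Fin 2) ℂ),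
      (∀ b : PBond (F.P K) 0, (∀ k, (b.src k - x₀ k).val < n) → (∀ k, (b.tgt k - x₀ k).val < n) → U b = U' b) → f U = f U')
    (hlip : ∀ U U' : GaugeField (F.P K) 0 (Matrix.specialUnitaryGroup (Fin 2) ℂ),
      |f U - f U'| ≤ Λ * Real.sqrt (∑ b : PBond (F.P K) 0, GaugeGroup.dist1 (U b * (U' b)⁻¹) ^ 2))
    (U : GaugeField (F.P K) 0 (Matrix.specialUnitaryGroup (Fin 2) ℂ)) {δ : ℝ} (hδ : 0 ≤ δ)
    (hU : PlaqSmallOn (boxPlaqs (fun k => ((x₀ k).val : ℤ)) (fun k => ((x₀ k).val : ℤ) + ((n : ℤ) - 1))) δ U) :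
    |f U - f (fun _ => 1)| ≤ Λ * (4 * (n : ℝ) ^ 3) * δ := by
  classical
  set lo : Fin (F.P K).d → ℤ := fun k => ((x₀ k).val : ℤ) with hlo
  set hi : Fin (F.P K).d → ℤ := fun k => ((x₀ k).val : ℤ) + ((n : ℤ) - 1) with hhi
  -- the axial-gauge copy and its cut-off to the box
  set V : GaugeField (F.P K) 0 (Matrix.specialUnitaryGroup (Fin 2) ℂ) := GaugeField.gaugeAct (axialGauge U lo hi) U with hV
  set W : GaugeField (F.P K) 0 (Matrix.specialUnitaryGroup (Fin 2) ℂ) := fun b =>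
    if (∀ k, (b.src k - x₀ k).val < n) ∧ (∀ k, (b.tgt k - x₀ k).val < n) then V b else 1 with hW
  have hfU : f U = f W := by
    rw [← hfG (axialGauge U lo hi) U]
    refine hloc _ _ fun b hs ht => ?_
    have hWb : W b = V b := if_pos ⟨hs, ht⟩
    rw [hWb]
  -- every box bond of the axial-gauge copy is within `2nδ` of `1`
  have hnN : n < (F.P K).sitesPerDir 0 := by omega
  have hbox : ∀ κ, hi κ ≤ lo κ + n := fun κ => by
    show ((x₀ κ).val : ℤ) + ((n : ℤ) - 1) ≤ ((x₀ κ).val : ℤ) + n; linarith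
  have hbond : ∀ b : PBond (F.P K) 0, (∀ k, (b.src k - x₀ k).val < n) → (∀ k, (b.tgt k - x₀ k).val < n) →
      GaugeGroup.dist1 (V b) ≤ 2 * n * δ := by
    intro b hs ht
    have h := dist1_gaugeAct_axialGauge_le_of_mem_boxBonds U subset_rfl hU hδ hbox hnN (mem_boxBonds_of_val_lt hn h2n x₀ b hs ht)
    simpa [T3Family.P_d] using h
  -- the Lipschitz row against `𝟙`
  have hW1 : ∀ b : PBond (F.P K) 0, GaugeGroup.dist1 (W b * ((fun _ => (1 : Matrix.specialUnitaryGroup (Fin 2) ℂ)) b)⁻¹) ^ 2 ≤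
      if (∀ k, (b.src k - x₀ k).val < n) then (2 * n * δ) ^ 2 else 0 := by
    intro b
    simp only [inv_one, mul_one]
    by_cases hs : ∀ k, (b.src k - x₀ k).val < n
    · rw [if_pos hs]
      by_cases ht : ∀ k, (b.tgt k - x₀ k).val < n
      · have hWb : W b = V b := if_pos ⟨hs, ht⟩
        rw [hWb]
        exact pow_le_pow_left₀ (GaugeGroup.dist1_nonneg _) (hbond b hs ht) 2
      · have hWb : W b = 1 := if_neg fun h => ht h.2
        rw [hWb, GaugeGroup.dist1_one, zero_pow two_ne_zero]
        positivity
    · rw [if_neg hs]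
      have hWb : W b = 1 := if_neg fun h => hs h.1
      rw [hWb, GaugeGroup.dist1_one, zero_pow two_ne_zero]
  have hsum : ∑ b : PBond (F.P K) 0, GaugeGroup.dist1 (W b * ((fun _ => (1 : Matrix.specialUnitaryGroup (Fin 2) ℂ)) b)⁻¹) ^ 2 ≤ 3 * (n : ℝ) ^ 3 * (2 * n * δ) ^ 2 := by
    calc ∑ b : PBond (F.P K) 0, GaugeGroup.dist1 (W b * ((fun _ => (1 : Matrix.specialUnitaryGroup (Fin 2) ℂ)) b)⁻¹) ^ 2
        ≤ ∑ b : PBond (F.P K) 0, (if (∀ k, (b.src k - x₀ k).val < n) then (2 * n * δ) ^ 2 else 0) := Finset.sum_le_sum fun b _ => hW1 b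
      _ = ((Finset.univ.filter fun b : PBond (F.P K) 0 => ∀ k, (b.src k - x₀ k).val < n).card : ℝ) * (2 * n * δ) ^ 2 := by
        rw [← Finset.sum_filter, Finset.sum_const, nsmul_eq_mul]
      _ ≤ 3 * (n : ℝ) ^ 3 * (2 * n * δ) ^ 2 := by
        gcongr
        have h := card_filter_src_val_lt_le (P := F.P K) (j := 0) (n := n) x₀
        simp only [T3Family.P_d] at h
        exact_mod_cast h
  have hn1 : (1 : ℝ) ≤ (n : ℝ) := by exact_mod_cast hn
  have hsq : 3 * (n : ℝ) ^ 3 * (2 * n * δ) ^ 2 ≤ (4 * (n : ℝ) ^ 3 * δ) ^ 2 := by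
    have h5 : (n : ℝ) ^ 5 ≤ (n : ℝ) ^ 6 := pow_le_pow_right₀ hn1 (by norm_num)
    nlinarith [sq_nonneg δ, pow_nonneg (zero_le_one.trans hn1) 5]
  have hroot : Real.sqrt (∑ b : PBond (F.P K) 0, GaugeGroup.dist1 (W b * ((fun _ => (1 : Matrix.specialUnitaryGroup (Fin 2) ℂ)) b)⁻¹) ^ 2) ≤ 4 * (n : ℝ) ^ 3 * δ := by
    calc Real.sqrt (∑ b : PBond (F.P K) 0, GaugeGroup.dist1 (W b * ((fun _ => (1 : Matrix.specialUnitaryGroup (Fin 2) ℂ)) b)⁻¹) ^ 2)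
        ≤ Real.sqrt ((4 * (n : ℝ) ^ 3 * δ) ^ 2) := Real.sqrt_le_sqrt (hsum.trans hsq)
      _ = 4 * (n : ℝ) ^ 3 * δ := Real.sqrt_sq (by positivity)
  calc |f U - f (fun _ => 1)| = |f W - f (fun _ => 1)| := by rw [hfU]
    _ ≤ Λ * Real.sqrt (∑ b : PBond (F.P K) 0, GaugeGroup.dist1 (W b * ((fun _ => (1 : Matrix.specialUnitaryGroup (Fin 2) ℂ)) b)⁻¹) ^ 2) := hlip W _
    _ ≤ Λ * (4 * (n : ℝ) ^ 3 * δ) := mul_le_mul_of_nonneg_left hroot hΛ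
    _ = Λ * (4 * (n : ℝ) ^ 3) * δ := by ring

end Member

/-! ## §3 The registered stub BY NAME -/

/-- ★★★ **`stub_axialCombTransfer` OF LINE 29 «CombPeierls», AS REGISTERED on stmt-QuantumFields-23532** (skeleton `Cruxes/HistoryTailL/Lines/comb_peierls.lean`,
sha16 34f13369a15a4c92; token-identical statement): for a box of side `n` at `x₀` (`1 ≤ n`, `2n ≤ sitesPerDir 0`), a gauge-invariant, box-local, `Λ`-link-Lipschitz
`f` (`0 ≤ Λ`): (i) `#boxPlaqs ≤ 3(n+1)³`; (ii) `|f U − f 𝟙| ≤ Λ·4n³·δ` whenever the box plaquettes are `δ`-small (`0 < δ`).  Proof: §2. [folklore] -/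
theorem stub_axialCombTransfer :
    ∀ (F : T3Family) (K n : ℕ) (x₀ : Site (F.P K) 0)
      (f : GaugeField (F.P K) 0 (Matrix.specialUnitaryGroup (Fin 2) ℂ) → ℝ) (Λ : ℝ), 0 ≤ Λ → 1 ≤ n → 2 * n ≤ (F.P K).sitesPerDir 0 →
      GaugeField.GaugeInvariant f →
      (∀ U U' : GaugeField (F.P K) 0 (Matrix.specialUnitaryGroup (Fin 2) ℂ),
        (∀ b : PBond (F.P K) 0, (∀ k, (b.src k - x₀ k).val < n) → (∀ k, (b.tgt k - x₀ k).val < n) → U b = U' b) → f U = f U') →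
      (∀ U U' : GaugeField (F.P K) 0 (Matrix.specialUnitaryGroup (Fin 2) ℂ),
        |f U - f U'| ≤ Λ * Real.sqrt (∑ b : PBond (F.P K) 0, GaugeGroup.dist1 (U b * (U' b)⁻¹) ^ 2)) →
      ((boxPlaqs (P := F.P K) (j := 0) (fun k => ((x₀ k).val : ℤ)) (fun k => ((x₀ k).val : ℤ) + ((n : ℤ) - 1))).ncard : ℝ)
          ≤ 3 * ((n : ℝ) + 1) ^ 3 ∧
      ∀ (U : GaugeField (F.P K) 0 (Matrix.specialUnitaryGroup (Fin 2) ℂ)) (δ : ℝ), 0 < δ →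
        PlaqSmallOn (boxPlaqs (fun k => ((x₀ k).val : ℤ)) (fun k => ((x₀ k).val : ℤ) + ((n : ℤ) - 1))) δ U →
        |f U - f (fun _ => 1)| ≤ Λ * (4 * (n : ℝ) ^ 3) * δ :=
  fun F K _n x₀ f _Λ hΛ hn h2n hfG hloc hlip =>
    ⟨ncard_boxPlaqs_le F K hn x₀, fun U _δ hδ hU => abs_sub_one_le_of_plaqSmallOn F K hn h2n x₀ f hΛ hfG hloc hlip U hδ.le hU⟩

end Summit.QuantumFields.YangMills.Theorems.CombPeierlsStubAxialCombTransfer
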